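import Summits.QuantumFields.YangMills.Theses.TransportPerturbation

/-!
# Assembly of route `TransportPerturbation` (rung R3 of LADDER-YM, leaf `T3YM3TorusStatement.YM3TorusSU2`; item stmt-QuantumFields-26922)

The route file's kernel-checked deciding theorem `closes` packaged as the proof of the route's `Assembly` item:
`LipschitzContraction → AlmostInvariance → LoopStringLipschitz → SolutionFamily → GibbsInvariance → YM3TorusSU2`.  No summit and no Clay statement is
proved here; the rung `YM3TorusSU2` (a RECORD rung) stays open behind the route's open cruxes (stmt-QuantumFields-26917, 26918) and supports
(26919–26921).  Filed by the width seat `ym-line-sfw-p2-w2` gen 16 (route affinity: rung R3); the route is draft-by-design and asks no staffing — this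
one-line bookkeeping item is closed only so that the ledger shows the route's open content exactly.
-/

namespace Summit.QuantumFields.YangMills.Theorems

open Summit.QuantumFields.YangMills.Theses.TransportPerturbation in
/-- The `Assembly` item of route `TransportPerturbation` holds: it is the route's deciding theorem `closes` read as an implication. Nothing about the mass gap. -/
theorem transportPerturbation_assembly : Summit.QuantumFields.YangMills.Theses.TransportPerturbation.Assembly :=
  fun h1 h2 h3 h4 h5 => closes h1 h2 h3 h4 h5

end Summit.QuantumFields.YangMills.Theorems
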